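import Summits.BirchSwinnertonDyer.Rank1Residual.X11b.ChaPairsMinimality
import Summits.BirchSwinnertonDyer.Rank1Residual.X11b.KrausMinimalityGeneralTwo
import Literature.NumberTheory.EllipticCurves.SzpiroLocalDataProofs
import Literature.NumberTheory.EllipticCurves.ModularCurveManinSemistableCoprimeFormProofs
import Literature.NumberTheory.DiophantineGeometry.ConductorExponentLeTwoProofs
import Literature.NumberTheory.DiophantineGeometry.ConductorExponentLeFiveProofs
import Literature.NumberTheory.DiophantineGeometry.ConductorExponentLeEightProofs
import HarnessLib

/-!
# Route `KatoDescentPotSupersingular` (rung K9, cell `bsd-potss`) — TOOL (route-free): the CONDUCTOR of a globally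
# minimal integer model BOUNDED IN THE KERNEL from its bad-prime data (`N_E ∣ B` by `decide`), and the instance
# `N(338d1) ∣ 338` for the small-conductor unit-anchor road of item 19386
# (a `--supports 19190 --as helper` file; seat `bsd-potss-k9-red9` g3; nothing booked, BSD is not proved by any of
# this, no item is closed by this file)

WHY.  The cell's per-class records below bsd.S31 (Creutz–Miller: full BSD for `r ≤ 1`, `N < 5000`) carry the conductor
as a BINDER `hN : W.conductorNorm ℤ < 5000` («no kernel conductor tool», seats k9-red9 g2 / k9-c4 g4:
`…WildUpperReducibleNineTorsionClasses`, `…WildFineSelmerSmallConductorAnchor`, `…WildFineSelmerSupersingularUnitAnchor`).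
The sibling `…WildUpperReducibleNineTorsionRecords` (this seat, p471355) discharged it for `54b1`, `1890r1` with a
two-disjunct tool (multiplicative `f_q = 1` / Ogg `f_q ≤ ord_q Δ_min`), which is useless at an ADDITIVE prime `q ≥ 5`
with large `ord_q Δ` — e.g. the K9 unit anchor `338d1` (`Δ = -2³·13⁹`, additive at `13`).  THIS FILE is the general
form, in a ROUTE-FREE module (no `Theses` import; X11b minimality tools + the conductor prelude only):

* `conductorNorm_dvd_of_localBounds`: for a globally minimal `W = [a₁,…,a₆]` over `ℤ` with `|Δ| = ∏ q^{e_q}` over a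
  list of primes and a bound `B ≠ 0`, if EVERY listed `q` satisfies one of
  (M) `q ∤ c₄ ∧ q ∣ B` — multiplicative, `f_q = 1` (Silverman ATAEC IV.10.2(b); tree
      `conductorExponent_eq_one_of_dvd_Δ_of_not_dvd_c₄`);
  (O) `q^{e_q+1} ∤ Δ ∧ q^{e_q} ∣ B` — Ogg's formula, `f_q ≤ ord_q Δ_min` (ATAEC IV.11.1; `conductorExponent_lt_of_not_pow_dvd`);
  (T) `5 ≤ q ∧ q² ∣ B` — tame conductor, `f_q ≤ 2` (ATAEC IV.10.4; `conductorExponent_le_two_of_five_le_natGenerator_holds`);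
  (W3) `q = 3 ∧ 3⁵ ∣ B` — `f₃ ≤ 5` (Brumer–Kramer / ATAEC IV.10.4; `conductorExponent_le_five_of_natGenerator_eq_three_holds`);
  (W2) `q = 2 ∧ 2⁸ ∣ B` — `f₂ ≤ 8` (`conductorExponent_le_eight_holds`),
  then `N_E ∣ B` (`conductorNorm_dvd_of_forall_conductorExponent_le`; a prime off the list has `f_q = 0`,
  `conductorExponent_eq_zero_of_not_dvd_Δ`).  All side conditions are decided by `decide +kernel` on the record
  `bad = [(q, e_q), …]`; `conductorNorm_lt_of_localBounds` is the `N < N₀` form.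
* `isElliptic_338d1`, `isGloballyMinimal_338d1`, `conductorNorm_338d1_dvd : N(338d1) ∣ 338` (`338d1 = [1, 1, 0, 504, -13112]`,
  `Δ = -2³·13⁹`, `c₄ = -11·13³`: (M) at `2`, (T) at `13`), hence `N(338d1) < 5000` — the `hN'` binder of
  `missingUpperBoundAt_wild_of_smallConductorUnitAnchor` / `…SupersingularUnitAnchor` for the seven ♯ rows of item 19386
  anchored at `338d1` (k9-c4 g4 memo UNIT-ANCHOR-ROAD) is a theorem.

HONEST FRAMING.  Kernel arithmetic of conductors (divisibility only: the EXACT exponent at an additive prime would need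
the component count of Tate's algorithm); nothing about BSD is asserted; typed ≠ proved ≠ endorsed; nothing booked.
THEOREMS ONLY (no definition, no new fact, no `sorry`).

References: [Silverman1994] IV.10.2, IV.10.4, IV.11.1; [Ogg1967]; [BrumerKramer1994] Thm. 6.2; [BombieriGubler2006]
12.5.9–12.5.10; [SilvermanAEC2009] VII.1 Rem. 1.1, VIII.8, C.16; [Cremona2006] Table 1 (338d1: N = 338).
-/

set_option autoImplicit false
-- sibling precedent (`KatoDescentPotSupersingularAssembly.lean`): the directory name repeats the summit name
set_option linter.dupNamespace false

noncomputable section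

open scoped Classical

namespace Summit.BirchSwinnertonDyer.BirchSwinnertonDyer.Theorems.ConductorBoundOfBadPrimes

open WeierstrassCurve IsDedekindDomain Rat.HeightOneSpectrum Literature.NumberTheory.EllipticCurves
  Literature.NumberTheory.EllipticCurves.Rank1Residual.X11RankOneCertificates
  Summit.BirchSwinnertonDyer.Rank1Residual

/-! ## §1 The tool -/

/-- A prime dividing `∏ q^{e_q}` over a list of primes is one of the listed `q`. [folklore] -/
private theorem exists_mem_of_prime_dvd_prod_pow {q : ℕ} (hq : q.Prime) :
    ∀ (l : List (ℕ × ℕ)), (∀ t ∈ l, t.1.Prime) → q ∣ (l.map fun t => t.1 ^ t.2).prod → ∃ t ∈ l, t.1 = q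
  | [], _, h => by
    simp only [List.map_nil, List.prod_nil, Nat.dvd_one] at h
    exact absurd h hq.one_lt.ne'
  | t :: l, hl, h => by
    rw [List.map_cons, List.prod_cons] at h
    rcases (Nat.Prime.dvd_mul hq).mp h with h1 | h1
    · exact ⟨t, List.mem_cons_self, ((Nat.prime_dvd_prime_iff_eq hq (hl t List.mem_cons_self)).mp
        (hq.dvd_of_dvd_pow h1)).symm⟩
    · obtain ⟨t', ht', h'⟩ :=
        exists_mem_of_prime_dvd_prod_pow hq l (fun t' ht' ↦ hl t' (List.mem_cons_of_mem _ ht')) h1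
      exact ⟨t', List.mem_cons_of_mem _ ht', h'⟩

/-- **`N_E ∣ B` from the bad-prime data of a globally minimal integer model — IN THE KERNEL** (the shape `decide`
evaluates: `bad = [(q, e_q), …]`, `|Δ| = ∏ q^{e_q}`, every `q` prime). At each listed `q` ONE of: (M) `q ∤ c₄ ∧ q ∣ B`
(multiplicative, `f_q = 1`, ATAEC IV.10.2(b)); (O) `q^{e_q+1} ∤ Δ ∧ q^{e_q} ∣ B` (Ogg, `f_q ≤ ord_q Δ_min`, IV.11.1);
(T) `5 ≤ q ∧ q² ∣ B` (tame, `f_q ≤ 2`, IV.10.4); (W3) `q = 3 ∧ 3⁵ ∣ B` (`f₃ ≤ 5`); (W2) `q = 2 ∧ 2⁸ ∣ B` (`f₂ ≤ 8`,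
Brumer–Kramer); a prime off the list has `f_q = 0`. Then `N_E = ∏ q^{f_q} ∣ B`.
[cite: Silverman1994, IV.10.2(b), IV.10.4 and IV.11.1] [cite: BrumerKramer1994, Thm 6.2] [cite: BombieriGubler2006, 12.5.9] -/
theorem conductorNorm_dvd_of_localBounds (a1 a2 a3 a4 a6 : ℤ) (W : WeierstrassCurve ℚ) [hE : W.IsElliptic]
    [hM : W.IsGloballyMinimal] (hW : W = ⟨a1, a2, a3, a4, a6⟩)
    (bad : List (ℕ × ℕ)) (hprime : ∀ t ∈ bad, t.1.Prime)
    (hsupp : (discOf [a1, a2, a3, a4, a6]).natAbs = (bad.map fun t => t.1 ^ t.2).prod)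
    {B : ℕ} (hB : B ≠ 0)
    (hbad : ∀ t ∈ bad, (¬ (t.1 : ℤ) ∣ c4Of [a1, a2, a3, a4, a6] ∧ t.1 ∣ B) ∨
      (¬ (t.1 : ℤ) ^ (t.2 + 1) ∣ discOf [a1, a2, a3, a4, a6] ∧ t.1 ^ t.2 ∣ B) ∨
      (5 ≤ t.1 ∧ t.1 ^ 2 ∣ B) ∨ (t.1 = 3 ∧ 3 ^ 5 ∣ B) ∨ (t.1 = 2 ∧ 2 ^ 8 ∣ B)) :
    W.conductorNorm ℤ ∣ B := by
  subst hW
  set W₀ : WeierstrassCurve ℤ := ⟨a1, a2, a3, a4, a6⟩ with hW₀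
  have hW : W₀.baseChange ℚ = ⟨a1, a2, a3, a4, a6⟩ := by
    ext <;> simp [hW₀, WeierstrassCurve.baseChange, WeierstrassCurve.map]
  have hΔW : W₀.Δ = discOf [a1, a2, a3, a4, a6] := by
    simp only [hW₀, WeierstrassCurve.Δ, WeierstrassCurve.b₂, WeierstrassCurve.b₄, WeierstrassCurve.b₆,
      WeierstrassCurve.b₈, discOf, invariants]
    ring
  have hcW : W₀.c₄ = c4Of [a1, a2, a3, a4, a6] := by
    simp only [hW₀, WeierstrassCurve.c₄, WeierstrassCurve.b₂, WeierstrassCurve.b₄, c4Of, invariants]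
    ring
  haveI hE' : (W₀.baseChange ℚ).IsElliptic := hW ▸ hE
  haveI hM' : (W₀.baseChange ℚ).IsGloballyMinimal := hW ▸ hM
  rw [← hW]
  refine conductorNorm_dvd_of_forall_conductorExponent_le (W₀.baseChange ℚ) hB fun p ↦ ?_
  have hp : (p : ℕ).Prime := p.2
  set v : HeightOneSpectrum ℤ := (primesEquiv (R := ℤ)).symm p with hv
  have hgen₀ : natGenerator v = (p : ℕ) := by
    rw [hv, Literature.NumberTheory.EllipticCurves.Rat.natGenerator_primesEquiv_symm]
  have hgen : (natGenerator v : ℤ) = ((p : ℕ) : ℤ) := by rw [hgen₀]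
  have hmin : (W₀.baseChange ℚ).IsMinimalAt v := IsGloballyMinimal.isMinimalAt_int _ v
  by_cases hdvd : ((p : ℕ) : ℤ) ∣ W₀.Δ
  · have hdvd' : (p : ℕ) ∣ (bad.map fun t => t.1 ^ t.2).prod := by
      rw [← hsupp, ← hΔW]; exact Int.natCast_dvd.mp hdvd
    obtain ⟨t, ht, htp⟩ := exists_mem_of_prime_dvd_prod_pow hp bad hprime hdvd'
    rcases hbad t ht with ⟨hc₄, htB⟩ | ⟨hnot, htB⟩ | ⟨h5, htB⟩ | ⟨h3, htB⟩ | ⟨h2, htB⟩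
    · have h1 : (W₀.baseChange ℚ).conductorExponent v = 1 :=
        conductorExponent_eq_one_of_dvd_Δ_of_not_dvd_c₄ hmin (by rw [hgen]; exact hdvd)
          (by rw [hgen, hcW, ← htp]; exact hc₄)
      rw [h1]
      exact (hp.dvd_iff_one_le_factorization hB).mp (htp ▸ htB)
    · have hlt : (W₀.baseChange ℚ).conductorExponent v < t.2 + 1 :=
        conductorExponent_lt_of_not_pow_dvd hmin (by rw [hgen, hΔW, ← htp]; exact hnot)
      have hle : t.2 ≤ B.factorization p := (hp.pow_dvd_iff_le_factorization hB).mp (htp ▸ htB)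
      omega
    · have hle : (W₀.baseChange ℚ).conductorExponent v ≤ 2 :=
        (W₀.baseChange ℚ).conductorExponent_le_two_of_five_le_natGenerator_holds v (by rw [hgen₀, ← htp]; exact h5)
      exact hle.trans ((hp.pow_dvd_iff_le_factorization hB).mp (htp ▸ htB))
    · have hle : (W₀.baseChange ℚ).conductorExponent v ≤ 5 :=
        (W₀.baseChange ℚ).conductorExponent_le_five_of_natGenerator_eq_three_holds v (by rw [hgen₀, ← htp, h3])
      have h3p : (p : ℕ) = 3 := htp ▸ h3
      exact hle.trans ((hp.pow_dvd_iff_le_factorization hB).mp (h3p ▸ htB))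
    · have hle : (W₀.baseChange ℚ).conductorExponent v ≤ 8 :=
        (W₀.baseChange ℚ).conductorExponent_le_eight_holds v
      have h2p : (p : ℕ) = 2 := htp ▸ h2
      exact hle.trans ((hp.pow_dvd_iff_le_factorization hB).mp (h2p ▸ htB))
  · rw [conductorExponent_eq_zero_of_not_dvd_Δ hmin (by rw [hgen]; exact hdvd)]
    exact Nat.zero_le _

/-- **`N_E < N₀` form** of `conductorNorm_dvd_of_localBounds` (`N_E ∣ B` and `B < N₀`). [folklore] -/
theorem conductorNorm_lt_of_localBounds (a1 a2 a3 a4 a6 : ℤ) (W : WeierstrassCurve ℚ) [W.IsElliptic]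
    [W.IsGloballyMinimal] (hW : W = ⟨a1, a2, a3, a4, a6⟩)
    (bad : List (ℕ × ℕ)) (hprime : ∀ t ∈ bad, t.1.Prime)
    (hsupp : (discOf [a1, a2, a3, a4, a6]).natAbs = (bad.map fun t => t.1 ^ t.2).prod)
    {B N₀ : ℕ} (hB : B ≠ 0) (hBN : B < N₀)
    (hbad : ∀ t ∈ bad, (¬ (t.1 : ℤ) ∣ c4Of [a1, a2, a3, a4, a6] ∧ t.1 ∣ B) ∨
      (¬ (t.1 : ℤ) ^ (t.2 + 1) ∣ discOf [a1, a2, a3, a4, a6] ∧ t.1 ^ t.2 ∣ B) ∨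
      (5 ≤ t.1 ∧ t.1 ^ 2 ∣ B) ∨ (t.1 = 3 ∧ 3 ^ 5 ∣ B) ∨ (t.1 = 2 ∧ 2 ^ 8 ∣ B)) :
    W.conductorNorm ℤ < N₀ :=
  (Nat.le_of_dvd (Nat.pos_of_ne_zero hB)
    (conductorNorm_dvd_of_localBounds a1 a2 a3 a4 a6 W hW bad hprime hsupp hB hbad)).trans_lt hBN

/-! ## §2 Instance: the K9 small-conductor unit anchor `338d1` -/

/-- `Δ(338d1) = -2³·13⁹ ≠ 0`: Cremona's model `338d1 = [1, 1, 0, 504, -13112]` is an elliptic curve. [folklore] -/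
theorem isElliptic_338d1 : (⟨1, 1, 0, 504, -13112⟩ : WeierstrassCurve ℚ).IsElliptic :=
  X11b.isElliptic_of_discOf_ne_zero 1 1 0 504 (-13112) (by decide +kernel)

/-- **`338d1 = [1, 1, 0, 504, -13112]` is globally minimal** (`|Δ| = 2³·13⁹`; Silverman's `q¹² ∤ Δ` at `2, 13`).
[cite: SilvermanAEC2009, VII.1 Remark 1.1] -/
theorem isGloballyMinimal_338d1 : (⟨1, 1, 0, 504, -13112⟩ : WeierstrassCurve ℚ).IsGloballyMinimal :=
  X11b.isGloballyMinimal_of_krausCriterion_support 1 1 0 504 (-13112) [(2, 1, 3), (13, 2, 9)]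
    (by intro t ht; simp only [List.mem_cons, List.not_mem_nil, or_false] at ht; rcases ht with rfl | rfl <;> norm_num)
    (by decide +kernel) (by decide +kernel)

/-- **`N(338d1) ∣ 338 = 2·13²` — IN THE KERNEL** (`c₄ = -11·13³` odd: multiplicative at `2`; additive at `13 ≥ 5`:
`f₁₃ ≤ 2`). Cremona: `N = 338` exactly. [cite: Silverman1994, IV.10.2(b) and IV.10.4] [cite: Cremona2006, Table 1 (338d1)] -/
theorem conductorNorm_338d1_dvd : (⟨1, 1, 0, 504, -13112⟩ : WeierstrassCurve ℚ).conductorNorm ℤ ∣ 338 := by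
  haveI := isElliptic_338d1
  haveI := isGloballyMinimal_338d1
  exact conductorNorm_dvd_of_localBounds 1 1 0 504 (-13112) _ (by ext <;> norm_num) [(2, 3), (13, 9)]
    (by intro t ht; simp only [List.mem_cons, List.not_mem_nil, or_false] at ht; rcases ht with rfl | rfl <;> norm_num)
    (by decide +kernel) (by norm_num) (by decide +kernel)

/-- **`N(338d1) < 5000`** — the `hN'` binder of the small-conductor unit-anchor road (`…WildFineSelmerSmallConductorAnchor`,
`…WildFineSelmerSupersingularUnitAnchor`) at the anchor `338d1`, discharged. [cite: Cremona2006, Table 1 (338d1)] -/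
theorem conductorNorm_338d1_lt : (⟨1, 1, 0, 504, -13112⟩ : WeierstrassCurve ℚ).conductorNorm ℤ < 5000 :=
  (Nat.le_of_dvd (by norm_num) conductorNorm_338d1_dvd).trans_lt (by norm_num)

end Summit.BirchSwinnertonDyer.BirchSwinnertonDyer.Theorems.ConductorBoundOfBadPrimes

end
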